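import Mathlib
import Summits.ValiantsHypothesis.ValiantsHypothesis.Theorems.BarrierLeverPartitionMinorsHitByVPHiddenStatesPencilObstruction

/-!
# Route BarrierLever — item `PartitionMinorsHitByVP` (stmt-ValiantsHypothesis-19717), line `hidden-states`:
# THE SHADOW OBSTRUCTION — a one-piece design whose top layer has a short `d`-shadow is singular for EVERY table

Helper file (`--supports stmt-ValiantsHypothesis-19717`; cell valiant-natproofs, rung V4, 𝒟-side door (c), registered line
`Cruxes/PartitionMinorsHitByVP/Lines/hidden_states.lean` v8; prover seat val-np-p6 gen 13). Definition-free; closes NO item.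

THE THEOREM (memo HOME/val-np-p6/g13/MEMO-valnp6-g13.md §6; it explains every one of the 137 star-layer failures of the one-piece
graded-colex design found by this seat's census, 0 mismatches). One piece, any number `K` of states, ANY table `tx`; the column family
`cols` is down-closed with members of `≤ t + 1` states, and `Sh` contains every `(t+1−d)`-subset of every `(t+1)`-member (the `d`-fold
SHADOW of the top layer). If the rows contain a `d`-STAR `{D ⊔ A : A ∈ 𝒜'}` (`|D| = d`, each `A` a `(t+1−d)`-set disjoint from `D`) with
`|𝒜'| > |Sh|`, and there are at least as many rows of size `≤ t` as columns of size `≤ t`, then the block-additive matrix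
`[∏_{a ∈ u i}(tx none a + Σ_{q ∈ cols k} tx (some q) a)]` is SINGULAR (`det_eq_zero_of_shadow`). `d = t` is the pencil
(`…PencilObstruction`, p636166); `d = t = 1` is the star obstruction (p560846).
PROOF. Expand every row as `Σ_B c_S(B)·[B ⊆ J]` (`exists_row_expansion`, `c_S(B) = 0` for `|B| > |S|`). Choose `β ≠ 0` on `𝒜'` killing
`Γ_B = Σ_A β_A c_A(B)` for all `B ∈ Sh` (fewer equations than unknowns). Then `R = Σ_A β_A · row(D ⊔ A) = Σ_{B',B} c_D(B') Γ_B [B' ∪ B ⊆ J]`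
has no surviving term of size `t + 1` on the column family (such a term needs `B' ∪ B` to be a top member, whence `B ∈ Sh` and `Γ_B = 0`),
so `R` and all rows of size `≤ t` lie in the span of the `≤ t`-member indicators — too many vectors: a nonzero left kernel vector.

WHAT THIS IS NOT: a no-go for ONE-PIECE (tight) designs; joins with surplus low members are untouched; nothing on crux 14610 or VP ≠ VNP.
-/

set_option linter.dupNamespace false

namespace Summit.ValiantsHypothesis.ValiantsHypothesis.Theorems.BarrierLever.HiddenStates

open Finset

noncomputable section

namespace BallDiag

/-- **THE SHADOW OBSTRUCTION.** See the module docstring. -/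
theorem det_eq_zero_of_shadow (h K r t d : ℕ) (tx : Option (Fin K) → Fin h → ℂ)
    (u : Fin r → Finset (Fin h)) (hu : Function.Injective u)
    (cols : Fin r → Finset (Fin K)) (hdown : ∀ k A, A ⊆ cols k → ∃ k', cols k' = A)
    (htop : ∀ k, (cols k).card ≤ t + 1)
    (Sh : Finset (Finset (Fin K)))
    (hSh : ∀ k B, (cols k).card = t + 1 → B ⊆ cols k → B.card + d = t + 1 → B ∈ Sh)
    (D : Finset (Fin h)) (hD : D.card = d) (𝒜' : Finset (Finset (Fin h)))
    (h𝒜' : ∀ A ∈ 𝒜', A.card + d = t + 1 ∧ Disjoint D A) (hlt : Sh.card < 𝒜'.card)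
    (hstar : ∀ A ∈ 𝒜', D ∪ A ∈ Set.range u)
    (hprofile : (Finset.univ.filter fun k => (cols k).card ≤ t).card ≤ (Finset.univ.filter fun i => (u i).card ≤ t).card) :
    (Matrix.of fun i k : Fin r => ∏ a ∈ u i, (tx none a + ∑ q ∈ cols k, tx (some q) a)).det = 0 := by
  classical
  -- (0) row expansions for every set
  have hexp := fun A : Finset (Fin h) => exists_row_expansion tx A
  choose c hc0 hc using hexp
  -- (1) the star coefficients `β`: kill `Γ_B` for `B ∈ Sh` (more unknowns than equations)
  let Tm : Matrix ↥Sh ↥𝒜' ℂ := fun B A => c A.1 B.1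
  have hker : LinearMap.ker Tm.mulVecLin ≠ ⊥ := by
    apply LinearMap.ker_ne_bot_of_finrank_lt
    rw [Module.finrank_fintype_fun_eq_card, Module.finrank_fintype_fun_eq_card, Fintype.card_coe, Fintype.card_coe]
    exact hlt
  obtain ⟨β, hβker, hβne⟩ := (Submodule.ne_bot_iff _).mp hker
  have hβSh : ∀ B : ↥Sh, ∑ A : ↥𝒜', c A.1 B.1 * β A = 0 := by
    intro B
    have h1 := congrFun (LinearMap.mem_ker.mp hβker) B
    rw [Matrix.mulVecLin_apply] at h1
    exact h1
  obtain ⟨A₀, hA₀⟩ : ∃ A : ↥𝒜', β A ≠ 0 := by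
    by_contra hno
    push Not at hno
    exact hβne (funext hno)
  let βf : Finset (Fin h) → ℂ := fun A => if hA : A ∈ 𝒜' then β ⟨A, hA⟩ else 0
  have hβf : ∀ A (hA : A ∈ 𝒜'), βf A = β ⟨A, hA⟩ := fun A hA => by simp only [βf, dif_pos hA]
  -- Γ and its vanishing on the shadow
  let Γ : Finset (Fin K) → ℂ := fun B => ∑ A ∈ 𝒜', βf A * c A B
  have hΓ : ∀ B ∈ Sh, Γ B = 0 := by
    intro B hB
    have h1 : Γ B = ∑ A : ↥𝒜', c A.1 B * β A := by
      simp only [Γ]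
      rw [Finset.sum_subtype 𝒜' (fun _ => Iff.rfl)]
      refine Finset.sum_congr rfl fun A _ => ?_
      have hA := hβf A.1 A.2
      rw [hA]
      ring
    rw [h1]
    exact hβSh ⟨B, hB⟩
  have hΓbig : ∀ B : Finset (Fin K), t + 1 < B.card + d → Γ B = 0 := by
    intro B hB
    refine Finset.sum_eq_zero fun A hA => ?_
    have := (h𝒜' A hA).1
    rw [hc0 A B (by omega), mul_zero]
  -- hidden points, rows, indicators, the span W
  let pt : Fin r → Fin h → ℂ := fun k a => tx none a + ∑ q ∈ cols k, tx (some q) a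
  let row : Finset (Fin h) → (Fin r → ℂ) := fun S k => ∏ a ∈ S, pt k a
  let ind : Finset (Fin K) → (Fin r → ℂ) := fun A k => if A ⊆ cols k then 1 else 0
  let W : Submodule ℂ (Fin r → ℂ) :=
    Submodule.span ℂ (Set.range fun k' : {k' : Fin r // (cols k').card ≤ t} => ind (cols k'.1))
  have hfinW : Module.finrank ℂ ↥W ≤ (Finset.univ.filter fun k => (cols k).card ≤ t).card := by
    refine (finrank_range_le_card _).trans ?_
    rw [Fintype.card_subtype]
  have hindW : ∀ A : Finset (Fin K), A.card ≤ t → ind A ∈ W := by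
    intro A hA
    by_cases hex : ∃ k', cols k' = A
    · obtain ⟨k', hk'⟩ := hex
      refine Submodule.subset_span ⟨⟨k', by rw [hk']; exact hA⟩, ?_⟩
      simp only [hk']
    · have : ind A = 0 := by
        funext k
        simp only [ind, Pi.zero_apply]
        rw [if_neg]
        intro hAk
        exact hex (hdown k A hAk)
      rw [this]
      exact W.zero_mem
  have hrow_eq : ∀ S : Finset (Fin h), row S = ∑ B : Finset (Fin K), c S B • ind B := by
    intro S
    funext k
    simp only [row, pt, Finset.sum_apply, Pi.smul_apply, smul_eq_mul, ind]
    rw [hc S (cols k)]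
  have hrowW : ∀ S : Finset (Fin h), S.card ≤ t → row S ∈ W := by
    intro S hS
    rw [hrow_eq S]
    refine Submodule.sum_mem _ fun B _ => ?_
    by_cases hB : B.card ≤ t
    · exact Submodule.smul_mem _ _ (hindW B hB)
    · rw [hc0 S B (by omega), zero_smul]
      exact W.zero_mem
  -- (2) the star combination `R` is in W
  let R : Fin r → ℂ := fun k => ∑ A ∈ 𝒜', βf A * row (D ∪ A) k
  have hRe : R = ∑ B' : Finset (Fin K), ∑ B : Finset (Fin K), (c D B' * Γ B) • ind (B' ∪ B) := by
    funext k
    simp only [R, Finset.sum_apply, Pi.smul_apply, smul_eq_mul, ind]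
    -- split each star row as `x^D · x^A`
    have h1 : ∀ A ∈ 𝒜', βf A * row (D ∪ A) k
        = βf A * ((∑ B' : Finset (Fin K), c D B' * (if B' ⊆ cols k then 1 else 0))
            * ∑ B : Finset (Fin K), c A B * (if B ⊆ cols k then 1 else 0)) := by
      intro A hA
      simp only [row]
      rw [Finset.prod_union (h𝒜' A hA).2]
      simp only [pt]
      rw [hc D (cols k), hc A (cols k)]
    rw [Finset.sum_congr rfl h1]
    -- expand the product of the two expansions
    have hind_mul : ∀ B' B : Finset (Fin K), (if B' ∪ B ⊆ cols k then (1 : ℂ) else 0)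
        = (if B' ⊆ cols k then 1 else 0) * (if B ⊆ cols k then 1 else 0) := by
      intro B' B
      by_cases hB' : B' ⊆ cols k
      · by_cases hB : B ⊆ cols k
        · rw [if_pos (Finset.union_subset hB' hB), if_pos hB', if_pos hB, mul_one]
        · rw [if_neg (fun h' => hB ((Finset.subset_union_right).trans h')), if_neg hB, mul_zero]
      · rw [if_neg (fun h' => hB' ((Finset.subset_union_left).trans h')), if_neg hB', zero_mul]
    have h2 : ∀ A ∈ 𝒜', βf A * ((∑ B' : Finset (Fin K), c D B' * (if B' ⊆ cols k then (1 : ℂ) else 0))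
          * ∑ B : Finset (Fin K), c A B * (if B ⊆ cols k then 1 else 0))
        = ∑ B' : Finset (Fin K), ∑ B : Finset (Fin K),
            c D B' * (βf A * c A B) * (if B' ∪ B ⊆ cols k then 1 else 0) := by
      intro A _
      rw [Finset.sum_mul_sum, Finset.mul_sum]
      refine Finset.sum_congr rfl fun B' _ => ?_
      rw [Finset.mul_sum]
      refine Finset.sum_congr rfl fun B _ => ?_
      rw [hind_mul B' B]
      ring
    rw [Finset.sum_congr rfl h2, Finset.sum_comm]
    refine Finset.sum_congr rfl fun B' _ => ?_
    rw [Finset.sum_comm]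
    refine Finset.sum_congr rfl fun B _ => ?_
    have h3 : ∑ A ∈ 𝒜', c D B' * (βf A * c A B) * (if B' ∪ B ⊆ cols k then (1 : ℂ) else 0)
        = (c D B' * ∑ A ∈ 𝒜', βf A * c A B) * (if B' ∪ B ⊆ cols k then 1 else 0) := by
      rw [Finset.mul_sum, Finset.sum_mul]
    rw [h3]
  have hRW : R ∈ W := by
    rw [hRe]
    refine Submodule.sum_mem _ fun B' _ => Submodule.sum_mem _ fun B _ => ?_
    by_cases hsmall : (B' ∪ B).card ≤ t
    · exact Submodule.smul_mem _ _ (hindW _ hsmall)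
    by_cases hB' : d < B'.card
    · rw [hc0 D B' (by omega), zero_mul, zero_smul]; exact W.zero_mem
    by_cases hB : t + 1 < B.card + d
    · rw [hΓbig B hB, mul_zero, zero_smul]; exact W.zero_mem
    -- now |B'| ≤ d, |B| + d ≤ t + 1, |B' ∪ B| ≥ t + 1: so B' ∪ B has exactly t + 1 elements and |B| + d = t + 1
    have hcard_union := Finset.card_union_le B' B
    have hBd : B.card + d = t + 1 := by omega
    by_cases hex : ∃ k, B' ∪ B ⊆ cols k
    · obtain ⟨k, hk⟩ := hex
      have hle := Finset.card_le_card hk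
      have hct : (cols k).card = t + 1 := by have := htop k; omega
      have hBSh : B ∈ Sh := hSh k B hct ((Finset.subset_union_right).trans hk) hBd
      rw [hΓ B hBSh, mul_zero, zero_smul]; exact W.zero_mem
    · have hzero : ind (B' ∪ B) = 0 := by
        funext k
        simp only [ind, Pi.zero_apply]
        rw [if_neg]
        intro hsub
        exact hex ⟨k, hsub⟩
      rw [hzero, smul_zero]; exact W.zero_mem
  -- (3) too many vectors in W
  let ι := {i : Fin r // (u i).card ≤ t} ⊕ Unit
  let fam : ι → ↥W := fun x => match x with
    | Sum.inl i => ⟨row (u i.1), hrowW _ i.2⟩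
    | Sum.inr _ => ⟨R, hRW⟩
  have hdep : ¬ LinearIndependent ℂ fam := by
    intro hli
    have h1 := hli.fintype_card_le_finrank
    have h2 : Fintype.card ι = (Finset.univ.filter fun i => (u i).card ≤ t).card + 1 := by
      simp only [ι, Fintype.card_sum, Fintype.card_unit, Fintype.card_subtype]
    rw [h2] at h1
    have := hfinW
    omega
  obtain ⟨g, hg, x₀, hx₀⟩ := Fintype.not_linearIndependent_iff.mp hdep
  have hgV : ∑ x : ι, g x • ((fam x : ↥W) : Fin r → ℂ) = 0 := by
    have := congrArg (fun w : ↥W => (w : Fin r → ℂ)) hg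
    simpa only [Submodule.coe_sum, Submodule.coe_smul, Submodule.coe_zero] using this
  -- (4) the left kernel vector
  let low : Fin r → ℂ := fun i => if hi : (u i).card ≤ t then g (Sum.inl ⟨i, hi⟩) else 0
  let pen : Fin r → ℂ := fun i => ∑ A ∈ 𝒜', if u i = D ∪ A then βf A else 0
  let cvec : Fin r → ℂ := fun i => low i + g (Sum.inr ()) * pen i
  have hcardDA : ∀ A ∈ 𝒜', (D ∪ A).card = t + 1 := by
    intro A hA
    rw [Finset.card_union_of_disjoint (h𝒜' A hA).2, hD]
    have := (h𝒜' A hA).1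
    omega
  have hDA_inj : ∀ A ∈ 𝒜', ∀ A' ∈ 𝒜', D ∪ A = D ∪ A' → A = A' := by
    intro A hA A' hA' hAA
    have h1 : (D ∪ A) \ D = A := by
      rw [Finset.union_sdiff_left]
      exact Finset.sdiff_eq_self_of_disjoint (h𝒜' A hA).2.symm
    have h2 : (D ∪ A') \ D = A' := by
      rw [Finset.union_sdiff_left]
      exact Finset.sdiff_eq_self_of_disjoint (h𝒜' A' hA').2.symm
    rw [← h1, ← h2, hAA]
  have hpen_low : ∀ i, (u i).card ≤ t → pen i = 0 := by
    intro i hi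
    refine Finset.sum_eq_zero fun A hA => ?_
    rw [if_neg]
    intro h'
    rw [h', hcardDA A hA] at hi
    omega
  have hfib : ∀ A ∈ 𝒜', ∀ f : Fin r → ℂ,
      ∑ i, (if u i = D ∪ A then f i else 0) = ∑ i ∈ Finset.univ.filter (fun i => u i = D ∪ A), f i := by
    intro A _ f
    rw [Finset.sum_filter]
  have hfib1 : ∀ A ∈ 𝒜', ∃ i₀, u i₀ = D ∪ A ∧ Finset.univ.filter (fun i => u i = D ∪ A) = {i₀} := by
    intro A hA
    obtain ⟨i₀, hi₀⟩ := hstar A hA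
    refine ⟨i₀, hi₀, ?_⟩
    ext i
    simp only [Finset.mem_filter, Finset.mem_univ, true_and, Finset.mem_singleton]
    constructor
    · intro hi; exact hu (hi.trans hi₀.symm)
    · rintro rfl; exact hi₀
  have hvec : Matrix.vecMul cvec (Matrix.of fun i k : Fin r => ∏ a ∈ u i, (tx none a + ∑ q ∈ cols k, tx (some q) a)) = 0 := by
    funext k
    have hk := congrFun hgV k
    rw [Finset.sum_apply, Pi.zero_apply, Fintype.sum_sum_type] at hk
    simp only [Pi.smul_apply, smul_eq_mul, Finset.univ_unique, Finset.sum_singleton, PUnit.default_eq_unit] at hk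
    rw [Matrix.vecMul, dotProduct, Pi.zero_apply]
    simp only [Matrix.of_apply]
    have hsplit : ∑ i, cvec i * ∏ a ∈ u i, (tx none a + ∑ q ∈ cols k, tx (some q) a)
        = ∑ i, low i * row (u i) k + g (Sum.inr ()) * ∑ i, pen i * row (u i) k := by
      simp only [cvec, row, pt, add_mul, Finset.sum_add_distrib, Finset.mul_sum, mul_assoc]
    rw [hsplit]
    have hlow : ∑ i, low i * row (u i) k = ∑ i : {i : Fin r // (u i).card ≤ t}, g (Sum.inl i) * row (u i.1) k := by
      rw [← Finset.sum_subset (Finset.subset_univ (Finset.univ.filter fun i => (u i).card ≤ t)),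
        Finset.sum_subtype (Finset.univ.filter fun i => (u i).card ≤ t) (p := fun i => (u i).card ≤ t)
          (fun i => by simp)]
      · refine Finset.sum_congr rfl fun i _ => ?_
        simp only [low, dif_pos i.2]
      · intro i _ hi
        have hi' : ¬ (u i).card ≤ t := fun h' => hi (Finset.mem_filter.mpr ⟨Finset.mem_univ _, h'⟩)
        simp only [low, dif_neg hi', zero_mul]
    have hpenR : ∑ i, pen i * row (u i) k = R k := by
      simp only [pen, R, Finset.sum_mul]
      rw [Finset.sum_comm]
      refine Finset.sum_congr rfl fun A hA => ?_
      obtain ⟨i₀, hi₀, hfil⟩ := hfib1 A hA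
      have : ∀ i, (if u i = D ∪ A then βf A else 0) * row (u i) k
          = if u i = D ∪ A then βf A * row (D ∪ A) k else 0 := by
        intro i
        by_cases h' : u i = D ∪ A
        · rw [if_pos h', if_pos h', h']
        · rw [if_neg h', if_neg h', zero_mul]
      rw [Finset.sum_congr rfl fun i _ => this i, hfib A hA, hfil, Finset.sum_singleton]
    rw [hlow, hpenR]
    have hfam : ∀ i : {i : Fin r // (u i).card ≤ t}, ((fam (Sum.inl i) : ↥W) : Fin r → ℂ) k = row (u i.1) k := fun i => rfl
    have hfamR : ((fam (Sum.inr ()) : ↥W) : Fin r → ℂ) k = R k := rfl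
    simp only [hfam, hfamR] at hk
    exact hk
  have hcne : cvec ≠ 0 := by
    intro hc0'
    rcases x₀ with i | _
    · have := congrFun hc0' i.1
      simp only [cvec, Pi.zero_apply, hpen_low i.1 i.2, mul_zero, add_zero, low, dif_pos i.2] at this
      exact hx₀ this
    · obtain ⟨i₀, hi₀, hfil⟩ := hfib1 A₀.1 A₀.2
      have := congrFun hc0' i₀
      have hlow0 : low i₀ = 0 := by
        have : ¬ (u i₀).card ≤ t := by rw [hi₀, hcardDA A₀.1 A₀.2]; omega
        simp only [low, dif_neg this]
      have hpen0 : pen i₀ = βf A₀.1 := by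
        simp only [pen]
        rw [Finset.sum_eq_single_of_mem A₀.1 A₀.2]
        · rw [if_pos hi₀]
        · intro A hA hne
          rw [if_neg]
          intro h'
          exact hne (hDA_inj A hA A₀.1 A₀.2 (h'.symm.trans hi₀))
      simp only [cvec, Pi.zero_apply, hlow0, zero_add, hpen0, hβf A₀.1 A₀.2] at this
      rcases mul_eq_zero.mp this with h' | h'
      · exact hx₀ h'
      · exact hA₀ h'
  exact Matrix.exists_vecMul_eq_zero_iff.mp ⟨cvec, hcne, hvec⟩

end BallDiag

end

end Summit.ValiantsHypothesis.ValiantsHypothesis.Theorems.BarrierLever.HiddenStates
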